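import Mathlib.Topology.Algebra.InfiniteSum.Real
import Mathlib.Topology.Algebra.InfiniteSum.NatInt
import Mathlib.Analysis.SpecificLimits.Basic
import Mathlib.Analysis.PSeries
import Mathlib.Data.Nat.Prime.Basic
import HarnessLib

/-!
# The simple sieve of Davenport–Heilbronn: finitely many local conditions plus a uniform tail estimate

Topic `Literature/NumberTheory/CubicFields`. The passage from counting theorems with FINITELY many
congruence conditions to sets cut out by local conditions at ALL primes, as carried out by
Bhargava–Shankar–Tsimerman, §8.3 (proof of Theorem 1; verbatim again in §8.5 for Corollary 7, the
mean size of the 3-torsion of class groups of quadratic fields, and in §8.4 for Theorem 25) and by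
Bhargava–Varma, §3.1 (the same argument, class-field-theory free): with `𝒰 = ∩_p 𝒰_p`,

> "Suppose `Y` is any positive integer. It follows from (ramanujan) that
> `lim_{X→∞} N(∩_{p<Y} 𝒰_p ∩ V^{(i)}; X)/X = (π²/12nᵢ) ∏_{p<Y} μ(𝒰_p)`. Letting `Y` tend to `∞`,
> we obtain immediately that `limsup_{X→∞} N(𝒰 ∩ V^{(i)}; X)/X ≤ (π²/12nᵢ) ∏_p μ(𝒰_p)`. To obtain
> a lower bound for `N(𝒰 ∩ V^{(i)}; X)`, we note that `∩_{p<Y} 𝒰_p ⊂ (𝒰 ∪ ∪_{p≥Y} 𝒲_p)`. Hence by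
> Proposition 23 [`N(𝒲_p; X) = O(X/p²)`, the implied constant independent of `p`],
> `lim_{X→∞} N(𝒰 ∩ V^{(i)}; X)/X ≥ (π²/12nᵢ) ∏_{p<Y} μ(𝒰_p) − O(Σ_{p≥Y} p⁻²)`. Letting `Y` tend to
> infinity completes the proof."

This file proves that argument ONCE, abstractly, so that each of its uses (Thm 1, Thm 25, Cor. 7 of
BST; Thm 1 of Bhargava–Varma) is a one-line specialisation. Nothing about binary cubic forms is
used: the data are

* a type `α` (in BST: `V_ℤ`), an ambient set `T ⊆ α` (`V^{(i)}`, or `V^{(i)} ∩ S`), local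
  conditions `U : ℕ → Set α` (`𝒰_p`; indices `p` that are not prime are simply given `U p = univ`
  by the user) and the windows `A X ⊆ α` (`{0 < |Disc| < X}`);
* a counting function `N : Set α → ℝ → ℝ` (`N(S; X)`, the number of irreducible `GL₂(ℤ)`-orbits —
  or `SL₂(ℤ)`-orbits — in `S` of absolute discriminant `< X`), about which only the following is
  assumed: it sees only the window (`N(S; X) = N(S ∩ A X; X)`), it is monotone and (finitely)
  subadditive in `S` with `N(∅; X) = 0` — true of orbit counts of arbitrary subsets, and of BST's
  averaged `N(S; X)` of (avg2), "`N(S₁ ∪ S₂) = N(S₁) + N(S₂)` for disjoint `S₁, S₂`";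
* the finiteness making "`∪_{p ≥ Y} 𝒲_p`" harmless at each fixed `X`: only `p < B(X)` can fail
  in the window (`hfin`; in BST, `f ∉ 𝒰_p` or `f ∉ 𝒱_p` forces `p² ∣ Disc(f)`, so `p² < X`);
* the finite-level limits `N(T ∩ ∩_{p<Y} U_p; X)/X → c · ∏_{p<Y} μ_p` (`hlevel`: BST (ramanujan) =
  Thm 20 with Lemma 13), the convergence of the partial products `∏_{p<Y} μ_p → M` (`hprod`), and
  the uniform tail estimate `N(T ∩ U_pᶜ; X) ≤ w_p · X` for `X ≥ X₀` with `Σ_p w_p < ∞` (`hunif`: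
  BST Prop. 23 with `w_p = C/p²`).

The conclusion is `N(T ∩ ∩_p U_p; X)/X → c · M` (`tendsto_count_iInter_div`). The analytic core —
an interchange of the limits in `X` and `Y` under a tail bound uniform in `X` — is isolated as
`tendsto_div_of_level_approx`.

## References

* M. Bhargava, A. Shankar, J. Tsimerman, *On the Davenport–Heilbronn theorems and second order
  terms*, Invent. Math. 193 (2013) 439–499 = arXiv:1005.0672, §8.3 (proof of Thm 1), §8.5
  [BhargavaShankarTsimerman2012].
* M. Bhargava, I. Varma, *The mean number of 3-torsion elements in the class groups and ideal
  groups of quadratic orders*, Proc. LMS 112 (2016) = arXiv:1401.5875, §3.1.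
* H. Davenport, H. Heilbronn, *On the density of discriminants of cubic fields. II*, Proc. Roy.
  Soc. London A 322 (1971) 405–420, §5 [DavenportHeilbronn1971].
-/

namespace Literature.NumberTheory.CubicFields

open Filter Finset
open scoped Topology BigOperators

/-! ### The analytic core: interchanging `lim_X` and `lim_Y` under a uniform tail bound -/

/-- **Interchange of limits under a uniform tail bound** (the analysis inside BST §8.3). Let
`g(X) ≤ a_Y(X)` for all `Y` (the set cut out by all conditions is contained in each finite level),
`a_Y(X) ≤ g(X) + e_Y · X` for all large `X` (the finite level exceeds it by at most the tail),
`a_Y(X)/X → c_Y` as `X → ∞` for each `Y` (finite-level counting theorem), `c_Y → L` and `e_Y → 0`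
as `Y → ∞`. Then `g(X)/X → L`. [cite: BhargavaShankarTsimerman2012, §8.3 (proof of Theorem 1: limsup and liminf in X, then Y → ∞)] -/
theorem tendsto_div_of_level_approx {g : ℝ → ℝ} {a : ℕ → ℝ → ℝ} {c e : ℕ → ℝ} {L : ℝ}
    (hga : ∀ Y X, g X ≤ a Y X)
    (hag : ∀ Y, ∀ᶠ X in atTop, a Y X ≤ g X + e Y * X)
    (ha : ∀ Y, Tendsto (fun X => a Y X / X) atTop (𝓝 (c Y)))
    (hc : Tendsto c atTop (𝓝 L))
    (he : Tendsto e atTop (𝓝 0)) :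
    Tendsto (fun X => g X / X) atTop (𝓝 L) := by
  rw [Metric.tendsto_nhds]
  intro ε hε
  have hε3 : 0 < ε / 3 := by positivity
  obtain ⟨Y₁, hY₁⟩ := Metric.tendsto_atTop.1 hc (ε / 3) hε3
  obtain ⟨Y₂, hY₂⟩ := Metric.tendsto_atTop.1 he (ε / 3) hε3
  have hcY : dist (c (max Y₁ Y₂)) L < ε / 3 := hY₁ _ (le_max_left _ _)
  have heY : dist (e (max Y₁ Y₂)) 0 < ε / 3 := hY₂ _ (le_max_right _ _)
  have haY := Metric.tendsto_nhds.1 (ha (max Y₁ Y₂)) (ε / 3) hε3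
  filter_upwards [haY, hag (max Y₁ Y₂), eventually_gt_atTop (0 : ℝ)] with X hX hX' hX0
  rw [Real.dist_eq, abs_lt] at hX hcY ⊢
  rw [Real.dist_eq, sub_zero, abs_lt] at heY
  have h1 : g X / X ≤ a (max Y₁ Y₂) X / X := div_le_div_of_nonneg_right (hga _ X) hX0.le
  have h2 : a (max Y₁ Y₂) X / X ≤ g X / X + e (max Y₁ Y₂) := by
    rw [div_le_iff₀ hX0, add_mul, div_mul_cancel₀ _ hX0.ne']
    exact hX'
  constructor <;> linarith [hcY.1, hcY.2, heY.1, heY.2, hX.1, hX.2]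

/-! ### Finite subadditivity of a counting function -/

variable {α : Type*}

/-- A binary-subadditive set function vanishing on `∅` is finitely subadditive. [folklore] -/
theorem apply_biUnion_le_sum {N : Set α → ℝ} (h0 : N ∅ = 0)
    (hsub : ∀ S S', N (S ∪ S') ≤ N S + N S') (s : Finset ℕ) (W : ℕ → Set α) :
    N (⋃ p ∈ s, W p) ≤ ∑ p ∈ s, N (W p) := by
  classical
  induction s using Finset.induction_on with
  | empty => simp [h0]
  | insert p s hp ih =>
    rw [Finset.set_biUnion_insert, Finset.sum_insert hp]
    exact (hsub _ _).trans (by linarith)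

/-- A monotone set function vanishing on `∅` is nonnegative. [folklore] -/
theorem apply_nonneg_of_mono {N : Set α → ℝ} (h0 : N ∅ = 0)
    (hmono : ∀ ⦃S S' : Set α⦄, S ⊆ S' → N S ≤ N S') (S : Set α) : 0 ≤ N S := by
  rw [← h0]
  exact hmono (Set.empty_subset S)

/-! ### The sieve -/

/-- The tail `Σ_{p ≥ Y} w_p` of a summable series, written as `Σ_p w_p − Σ_{p<Y} w_p`, tends to
`0` as `Y → ∞`. [folklore] -/
theorem tendsto_tsum_sub_sum_range {w : ℕ → ℝ} (hw : Summable w) :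
    Tendsto (fun Y => ∑' p, w p - ∑ p ∈ Finset.range Y, w p) atTop (𝓝 0) := by
  have h := hw.hasSum.tendsto_sum_nat
  have : Tendsto (fun Y => ∑' p, w p - ∑ p ∈ Finset.range Y, w p) atTop
      (𝓝 (∑' p, w p - ∑' p, w p)) := tendsto_const_nhds.sub h
  rwa [sub_self] at this

/-- A finite sum of nonnegative terms indexed inside `[Y, ∞)` is at most the tail
`Σ_p w_p − Σ_{p<Y} w_p`. [folklore] -/
theorem sum_le_tsum_sub_sum_range {w : ℕ → ℝ} (hw : Summable w) (hw0 : ∀ p, 0 ≤ w p)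
    {F : Finset ℕ} {Y : ℕ} (hF : ∀ p ∈ F, Y ≤ p) :
    ∑ p ∈ F, w p ≤ ∑' p, w p - ∑ p ∈ Finset.range Y, w p := by
  classical
  have hdisj : Disjoint (Finset.range Y) F := by
    rw [Finset.disjoint_left]
    intro p hp hpF
    exact absurd (hF p hpF) (not_le.2 (Finset.mem_range.1 hp))
  have h := Summable.sum_le_tsum (Finset.range Y ∪ F) (fun p _ => hw0 p) hw
  rw [Finset.sum_union hdisj] at h
  linarith

/-- **The Davenport–Heilbronn sieve** (BST §8.3, proof of Thm 1; §8.5 for Cor. 7; Bhargava–Varma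
§3.1). Let `N(S; X)` be a counting function on subsets of `α` which only sees the window `A X`,
is monotone and subadditive with `N(∅; X) = 0`; let `T` be an ambient set and `U_p` (`p ∈ ℕ`)
local conditions such that inside the window at height `X` only indices `p < B(X)` can fail
(`hfin`). Assume the finite-level counting theorem `N(T ∩ ∩_{p<Y} U_p; X)/X → c ∏_{p<Y} μ_p` for
every `Y` (BST (ramanujan)), `∏_{p<Y} μ_p → M`, and the uniformity estimate
`N(T ∩ U_pᶜ; X) ≤ w_p X` for `X ≥ X₀` with `Σ_p w_p < ∞` (BST Prop. 23: `w_p = C/p²`). Then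
`N(T ∩ ∩_p U_p; X)/X → c · M`. [cite: BhargavaShankarTsimerman2012, §8.3 (proof of Theorem 1) and §8.5] -/
theorem tendsto_count_iInter_div (N : Set α → ℝ → ℝ) (T : Set α) (U : ℕ → Set α)
    (A : ℝ → Set α) {w μ : ℕ → ℝ} {c M X₀ : ℝ}
    (hloc : ∀ S X, N S X = N (S ∩ A X) X)
    (hmono : ∀ ⦃S S' : Set α⦄ (X : ℝ), S ⊆ S' → N S X ≤ N S' X)
    (hsub : ∀ (S S' : Set α) (X : ℝ), N (S ∪ S') X ≤ N S X + N S' X)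
    (hempty : ∀ X, N ∅ X = 0)
    (hfin : ∀ X, ∃ B : ℕ, ∀ p, B ≤ p → T ∩ A X ⊆ U p)
    (hlevel : ∀ Y : ℕ, Tendsto (fun X => N (T ∩ ⋂ p ∈ Finset.range Y, U p) X / X) atTop
      (𝓝 (c * ∏ p ∈ Finset.range Y, μ p)))
    (hprod : Tendsto (fun Y : ℕ => ∏ p ∈ Finset.range Y, μ p) atTop (𝓝 M))
    (hw : Summable w)
    (hunif : ∀ (p : ℕ) (X : ℝ), X₀ ≤ X → N (T ∩ (U p)ᶜ) X ≤ w p * X) :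
    Tendsto (fun X => N (T ∩ ⋂ p, U p) X / X) atTop (𝓝 (c * M)) := by
  classical
  -- nonnegativity of `N` and of the weights
  have hN0 : ∀ S X, 0 ≤ N S X := fun S X =>
    apply_nonneg_of_mono (hempty X) (fun S S' h => hmono X h) S
  have hw0 : ∀ p, 0 ≤ w p := by
    intro p
    have h := (hN0 _ _).trans (hunif p (max X₀ 1) (le_max_left _ _))
    have h1 : (0 : ℝ) < max X₀ 1 := lt_of_lt_of_le one_pos (le_max_right _ _)
    exact nonneg_of_mul_nonneg_left h h1
  -- the tail weights
  set e : ℕ → ℝ := fun Y => ∑' p, w p - ∑ p ∈ Finset.range Y, w p with he_def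
  refine tendsto_div_of_level_approx (a := fun Y X => N (T ∩ ⋂ p ∈ Finset.range Y, U p) X)
    (c := fun Y => c * ∏ p ∈ Finset.range Y, μ p) (e := e) ?_ ?_ hlevel (hprod.const_mul c)
    (tendsto_tsum_sub_sum_range hw)
  · -- `T ∩ ∩_p U_p ⊆ T ∩ ∩_{p<Y} U_p`
    intro Y X
    refine hmono X (Set.inter_subset_inter_right _ ?_)
    exact Set.iInter_mono fun p => Set.subset_iInter fun _ => le_rfl
  · -- `∩_{p<Y} U_p ⊆ (∩_p U_p) ∪ ∪_{Y ≤ p < B(X)} U_pᶜ` inside the window, then subadditivity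
    intro Y
    filter_upwards [eventually_ge_atTop X₀, eventually_ge_atTop (0 : ℝ)] with X hX hX0
    obtain ⟨B, hB⟩ := hfin X
    set F : Finset ℕ := (Finset.Ico Y B) with hF_def
    have hcover : (T ∩ ⋂ p ∈ Finset.range Y, U p) ∩ A X ⊆
        (T ∩ ⋂ p, U p) ∪ ⋃ p ∈ F, (T ∩ (U p)ᶜ) := by
      intro x hx
      obtain ⟨⟨hxT, hxY⟩, hxA⟩ := hx
      by_cases hall : ∀ p, x ∈ U p
      · exact Or.inl ⟨hxT, Set.mem_iInter.2 hall⟩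
      · push Not at hall
        obtain ⟨p, hp⟩ := hall
        refine Or.inr (Set.mem_biUnion (x := p) ?_ ⟨hxT, hp⟩)
        rw [hF_def, Finset.coe_Ico, Set.mem_Ico]
        constructor
        · by_contra hpY
          push Not at hpY
          have := Set.mem_iInter₂.1 hxY p (Finset.mem_range.2 hpY)
          exact hp this
        · by_contra hpB
          push Not at hpB
          exact hp (hB p hpB ⟨hxT, hxA⟩)
    calc N (T ∩ ⋂ p ∈ Finset.range Y, U p) X
        = N ((T ∩ ⋂ p ∈ Finset.range Y, U p) ∩ A X) X := hloc _ X
      _ ≤ N ((T ∩ ⋂ p, U p) ∪ ⋃ p ∈ F, (T ∩ (U p)ᶜ)) X := hmono X hcover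
      _ ≤ N (T ∩ ⋂ p, U p) X + N (⋃ p ∈ F, (T ∩ (U p)ᶜ)) X := hsub _ _ X
      _ ≤ N (T ∩ ⋂ p, U p) X + ∑ p ∈ F, N (T ∩ (U p)ᶜ) X := by
          gcongr
          exact apply_biUnion_le_sum (N := fun S => N S X) (hempty X) (fun S S' => hsub S S' X) F _
      _ ≤ N (T ∩ ⋂ p, U p) X + ∑ p ∈ F, w p * X := by
          gcongr with p hp
          exact hunif p X hX
      _ = N (T ∩ ⋂ p, U p) X + (∑ p ∈ F, w p) * X := by rw [Finset.sum_mul]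
      _ ≤ N (T ∩ ⋂ p, U p) X + e Y * X := by
          gcongr
          exact sum_le_tsum_sub_sum_range hw hw0 fun p hp => (Finset.mem_Ico.1 hp).1

/-! ### The same, with the local conditions indexed by the primes -/

/-- Partial Euler products: if `∏_p μ_p` converges (as a `HasProd` over `Nat.Primes`) to `M`, then
the partial products over the primes `p < Y` tend to `M` as `Y → ∞`. [folklore] -/
theorem tendsto_prod_filter_prime_of_hasProd {μ : ℕ → ℝ} {M : ℝ}
    (h : HasProd (fun p : Nat.Primes => μ p) M) :
    Tendsto (fun Y : ℕ => ∏ p ∈ (Finset.range Y).filter Nat.Prime, μ p) atTop (𝓝 M) := by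
  classical
  -- `HasProd` over `Nat.Primes = {p // p.Prime}` is convergence along all finite sets of primes
  have h' : Tendsto (fun t : Finset {p : ℕ // p.Prime} => ∏ p ∈ t, μ (p : ℕ)) atTop (𝓝 M) := h
  let s : ℕ → Finset {p : ℕ // p.Prime} := fun Y => ((Finset.range Y).filter Nat.Prime).subtype Nat.Prime
  have hs : ∀ Y, ∏ p ∈ s Y, μ (p : ℕ) = ∏ p ∈ (Finset.range Y).filter Nat.Prime, μ p := by
    intro Y
    show ∏ p ∈ ((Finset.range Y).filter Nat.Prime).subtype Nat.Prime, μ (p : ℕ) = _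
    rw [Finset.prod_subtype_eq_prod_filter, Finset.filter_filter]
    simp
  have hmono : Tendsto s atTop atTop := by
    rw [tendsto_atTop_atTop]
    intro b
    refine ⟨b.sup (fun p => (p : ℕ)) + 1, fun Y hY p hp => ?_⟩
    show p ∈ ((Finset.range Y).filter Nat.Prime).subtype Nat.Prime
    rw [Finset.mem_subtype, Finset.mem_filter, Finset.mem_range]
    refine ⟨?_, p.2⟩
    have : (p : ℕ) ≤ b.sup (fun p => (p : ℕ)) :=
      Finset.le_sup (f := fun p : {p : ℕ // p.Prime} => (p : ℕ)) hp
    omega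
  have h2 := h'.comp hmono
  refine (tendsto_congr fun Y => ?_).1 h2
  simp only [Function.comp_apply]
  exact hs Y

/-- **The Davenport–Heilbronn sieve, prime-indexed form** (BST §8.3 / §8.5; Bhargava–Varma
§3.1): local conditions `U_p` at the primes `p`, finite-level counting theorem for `∩_{p<Y} U_p`
with main term `c ∏_{p<Y} μ_p`, Euler product `∏_p μ_p = M` (a `HasProd`), and the uniformity
estimate `N(T ∩ U_pᶜ; X) ≤ C X/p²` (`X ≥ X₀`, `C` independent of `p`; BST Prop. 23). Then
`N(T ∩ ∩_p U_p; X)/X → c M`. [cite: BhargavaShankarTsimerman2012, §8.3 (proof of Theorem 1) and §8.5 (Corollary 7)] -/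
theorem tendsto_count_iInter_prime_div (N : Set α → ℝ → ℝ) (T : Set α) (U : ℕ → Set α)
    (A : ℝ → Set α) {μ : ℕ → ℝ} {c M C X₀ : ℝ}
    (hloc : ∀ S X, N S X = N (S ∩ A X) X)
    (hmono : ∀ ⦃S S' : Set α⦄ (X : ℝ), S ⊆ S' → N S X ≤ N S' X)
    (hsub : ∀ (S S' : Set α) (X : ℝ), N (S ∪ S') X ≤ N S X + N S' X)
    (hempty : ∀ X, N ∅ X = 0)
    (hfin : ∀ X, ∃ B : ℕ, ∀ p, p.Prime → B ≤ p → T ∩ A X ⊆ U p)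
    (hlevel : ∀ Y : ℕ, Tendsto
      (fun X => N (T ∩ ⋂ p ∈ (Finset.range Y).filter Nat.Prime, U p) X / X) atTop
      (𝓝 (c * ∏ p ∈ (Finset.range Y).filter Nat.Prime, μ p)))
    (hprod : HasProd (fun p : Nat.Primes => μ p) M)
    (hunif : ∀ p : ℕ, p.Prime → ∀ X : ℝ, X₀ ≤ X → N (T ∩ (U p)ᶜ) X ≤ C * X / (p : ℝ) ^ 2) :
    Tendsto (fun X => N (T ∩ ⋂ p ∈ {p : ℕ | p.Prime}, U p) X / X) atTop (𝓝 (c * M)) := by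
  classical
  -- extend the data trivially to all indices
  let U' : ℕ → Set α := fun p => if p.Prime then U p else Set.univ
  let μ' : ℕ → ℝ := fun p => if p.Prime then μ p else 1
  have hU' : (⋂ p, U' p) = ⋂ p ∈ {p : ℕ | p.Prime}, U p := by
    ext x
    simp only [U', Set.mem_iInter, Set.mem_setOf_eq]
    constructor
    · intro h p hp
      simpa [hp] using h p
    · intro h p
      by_cases hp : p.Prime
      · simpa [hp] using h p hp
      · simp [hp]
  have hU'Y : ∀ Y, (⋂ p ∈ Finset.range Y, U' p) = ⋂ p ∈ (Finset.range Y).filter Nat.Prime, U p := by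
    intro Y
    ext x
    simp only [U', Set.mem_iInter, Finset.mem_filter]
    constructor
    · intro h p hp
      simpa [hp.2] using h p hp.1
    · intro h p hp
      by_cases hpr : p.Prime
      · simpa [hpr] using h p ⟨hp, hpr⟩
      · simp [hpr]
  have hμ'Y : ∀ Y, ∏ p ∈ Finset.range Y, μ' p = ∏ p ∈ (Finset.range Y).filter Nat.Prime, μ p := by
    intro Y
    rw [Finset.prod_filter]
  have hN0 : ∀ S X, 0 ≤ N S X := fun S X =>
    apply_nonneg_of_mono (hempty X) (fun S S' h => hmono X h) S
  -- summable weights `max C 0 / p²`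
  have hw : Summable fun p : ℕ => max C 0 / (p : ℝ) ^ 2 := by
    have h := (Real.summable_one_div_nat_pow.2 one_lt_two).mul_left (max C 0)
    refine h.congr fun p => ?_
    rw [mul_one_div]
  rw [← hU']
  refine tendsto_count_iInter_div N T U' A (w := fun p : ℕ => max C 0 / (p : ℝ) ^ 2) (μ := μ')
    (X₀ := max X₀ 0) hloc hmono hsub hempty ?_ ?_ ?_ hw ?_
  · intro X
    obtain ⟨B, hB⟩ := hfin X
    refine ⟨B, fun p hp => ?_⟩
    by_cases hpr : p.Prime
    · simpa [U', hpr] using hB p hpr hp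
    · simp [U', hpr]
  · intro Y
    rw [hU'Y, hμ'Y]
    exact hlevel Y
  · refine (tendsto_congr fun Y => ?_).2 (tendsto_prod_filter_prime_of_hasProd hprod)
    exact hμ'Y Y
  · intro p X hX
    have hX0 : 0 ≤ X := le_trans (le_max_right _ _) hX
    by_cases hpr : p.Prime
    · have h1 := hunif p hpr X (le_trans (le_max_left _ _) hX)
      have hU'p : U' p = U p := by simp [U', hpr]
      rw [hU'p]
      refine h1.trans ?_
      rw [div_mul_eq_mul_div]
      gcongr
      exact le_max_left _ _
    · have hU'p : U' p = Set.univ := by simp [U', hpr]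
      rw [hU'p, Set.compl_univ, Set.inter_empty, hempty]
      positivity

end Literature.NumberTheory.CubicFields
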